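import Literature.AlgebraicGeometry.Resolution.Blowups
import Literature.AlgebraicGeometry.Resolution.EffectiveResolution
import Literature.AlgebraicGeometry.Resolution.ResolutionOfCurves
import Mathlib.AlgebraicGeometry.Morphisms.ClosedImmersion
import Mathlib.AlgebraicGeometry.FunctionField
import Mathlib.AlgebraicGeometry.Noetherian
import HarnessLib

/-!
# Embedded resolution by blow-ups ⇒ resolution; BGMW 2011 Cor. 8.0.6 in embedded form

Topic: `Literature/AlgebraicGeometry/Resolution`. Second layer of the decomposition of the named
fact `BierstoneGrigorievMilmanWlodarczyk2011` (`EffectiveResolution.lean`; Bierstone–Grigoriev–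
Milman–Włodarczyk 2011, Cor. 8.0.6 of the arXiv version = Cor. 7.0.6 of the journal version:
canonical embedded resolution of singularities of `Y ⊂ 𝔸ⁿ` in characteristic
`p > M(d, n, l)`), following the architecture of the printed proof:

* BGMW §3.3 ("Hironaka resolution principle"): resolution of marked ideals ⇒ principalization ⇒
  weak embedded desingularization (Thm. 2.0.2: a finite sequence of blow-ups of the smooth
  ambient variety in smooth centres disjoint from `Reg(Y)`, after which the strict transform of
  `Y` is smooth) ⇒ desingularization (Thm. 2.0.3: a proper birational `Ỹ → Y`, `Ỹ` smooth).
* §8 (appendix): Thm. 8.0.4/8.0.5 — the characteristic-zero algorithm for marked ideals runs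
  unchanged in characteristic `p` as long as all multiplicities stay `< p`; Lemma 8.0.3 (1) —
  for `Y ⊂ 𝔸ⁿ` cut out by `l` polynomials of degree `≤ d` they are bounded by a function
  `M(d, n, l)` (in Grzegorczyk's class `𝓔^{n+3}`, §§5–7); whence Cor. 8.0.6.

This file PROVES the last implication of the chain (embedded desingularization ⇒ resolution in
the weak sense `Scheme.HasResolution` of `ResolutionOfSingularities.lean`) over Mathlib, for an
integral closed subscheme of a locally Noetherian scheme, from the universal property of blow-ups
(`Blowups.lean`) and the named fact `Stacks02NS` (blow-ups along ideals of finite type are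
proper: Stacks 02NS, GW I Prop. 13.96 (1)), and VENDORS the
rest of the chain as one named fact, `BierstoneGrigorievMilmanWlodarczyk2011_embedded`
(Cor. 8.0.6 in the embedded form of Thm. 2.0.2 (1)–(3), minus normal crossings, for integral
`Y`). The assembled reduction is `bierstoneGrigorievMilmanWlodarczyk2011_of_embedded`.

## Content (namespace `Literature.AlgGeom`)

* Fibres and closures for a morphism which is an isomorphism over an open `W`:
  `existsUnique_preimage_of_isIso_morphismRestrict`, `isOpen_image_of_isIso_morphismRestrict`,
  `preimage_closure_inter_subset_of_isIso_morphismRestrict` [folklore].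
* `IsEmbeddedTransform Y T σ Y'` — inductive: `σ : X' ⟶ X` is a composite of finitely many
  blow-ups (`IsBlowup`) whose centres `V(Cᵢ)` are regular schemes lying over `T ⊆ X`, and
  `Y' ⊆ X'` is the iterated strict transform of the subset `Y ⊆ X` (closure of the preimage of
  `Yᵢ ∖ V(Cᵢ)` at each step; GW I (13.19)). This is the data of BGMW Thm. 2.0.2 (1)–(2) without
  the normal-crossings conditions, with `T = X ∖ Reg(Y)`.
* `IsEmbeddedTransform.isProper_and_exists` — for `Y = closure {ξ}` with `ξ ∉ T`: `σ` is proper,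
  an isomorphism over an open `V ⊇ X ∖ T`, and `Y' = closure {ξ'}` for the unique `ξ'` over `ξ`
  (induction; each blow-up is proper (`Stacks02NS`) and an isomorphism off its centre,
  GW Prop. 13.91 (3) — `IsBlowup.isIso_morphismRestrict`).
* `hasResolution_of_isEmbeddedTransform` — BGMW (3) ⇒ (4) / Thm. 2.0.2 ⇒ Thm. 2.0.3 in the weak
  form: if the reduced closed subscheme on `Y'` is regular, `Y` has a resolution (proper:
  blow-ups and closed immersions; birational: an isomorphism over `ι⁻¹(V) ∋` generic point).
* `affineZeroLocusι k n S : affineZeroLocus k n S ⟶ 𝔸ⁿ_k` (closed immersion),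
  `BierstoneGrigorievMilmanWlodarczyk2011_embedded` — NAMED FACT (Cor. 8.0.6, embedded form),
  `bierstoneGrigorievMilmanWlodarczyk2011_of_embedded` — PROVED:
  `Stacks02NS → BierstoneGrigorievMilmanWlodarczyk2011_embedded →
  BierstoneGrigorievMilmanWlodarczyk2011`.

## Sources

* E. Bierstone, D. Grigoriev, P. Milman, J. Włodarczyk, *Effective Hironaka resolution and its
  complexity (with appendix on applications in positive characteristic)*, Asian J. Math. 15
  (2011) 193–228 = arXiv:1206.3090: Thms. 2.0.2, 2.0.3 (p. 5), §3.3 (pp. 6–7), §8: Lemma 8.0.3,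
  Thms. 8.0.4, 8.0.5, Remark (Galois descent), Cor. 8.0.6 (p. 23) — arXiv numbering.
* U. Görtz, T. Wedhorn, *Algebraic Geometry I*, 2nd ed. (2020), (13.19): Def. 13.90,
  Prop. 13.91 (3), Prop. 13.96 and the description of the strict transform (p. 413 ff.).

## Faithfulness notes

* Centres: BGMW blow up *smooth* centres; we record `Scheme.IsRegular (V(Cᵢ))` (smooth over a
  field ⇒ regular), so the vendored existence statement is weaker than printed.
* Condition (2) of Thm. 2.0.2, "all centers `Cᵢ` are disjoint from the set `Reg(Y) ⊂ Yᵢ` of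
  points where `Y` (not `Yᵢ`) is smooth", identifies `Reg(Y)` with its (isomorphic) preimage in
  the strict transform `Yᵢ`; it is rendered as: the image of `V(Cᵢ)` in `X = 𝔸ⁿ` does not meet
  the image of `Reg(Y) = {y | 𝒪_{Y,y} regular}` (= smooth points, `k` perfect) — equivalent to
  the printed condition because, inductively, the composite of the previous blow-ups is an
  isomorphism over a neighbourhood of `Reg(Y)` (`isProper_and_exists`).
* Strict transform: only its underlying closed set is tracked (`IsEmbeddedTransform`); the
  conclusion "`Y_r` smooth" (3) is recorded as: the reduced induced closed subscheme on that set
  (Mathlib's `vanishingIdeal`) is a regular scheme. For integral `Y` whose generic point is not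
  under a centre the iterated strict transform is integral (so its structure is the reduced one)
  and irreducible — proved in `isProper_and_exists` (`Y' = closure {ξ'}`).
-/

noncomputable section

open CategoryTheory CategoryTheory.Limits AlgebraicGeometry TopologicalSpace Topology

namespace Literature.AlgebraicGeometry.Resolution

universe u

/-! ## Morphisms that are isomorphisms over an open: fibres and closures -/

section IsoOver

variable {X Y : Scheme.{u}} (f : X ⟶ Y) {W : Y.Opens}

/-- If `f` is an isomorphism over the open `W ⊆ Y`, every point of `W` has exactly one preimage
under `f`. [folklore] -/
theorem existsUnique_preimage_of_isIso_morphismRestrict (hW : IsIso (f ∣_ W)) {y : Y}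
    (hy : y ∈ W) : ∃! x : X, f x = y := by
  let e := Scheme.homeoOfIso (asIso (f ∣_ W))
  have he : ∀ z : ↥(f ⁻¹ᵁ W), (e z).1 = f z.1 := fun z =>
    morphismRestrict_base_coe f W z
  let y' : ↥(W : Scheme.{u}) := ⟨y, hy⟩
  refine ⟨(e.symm y').1, (he _).symm.trans (congrArg Subtype.val (e.apply_symm_apply y')), ?_⟩
  intro x (hx : f x = y)
  have hxW : x ∈ f ⁻¹ᵁ W := show f x ∈ W by rw [hx]; exact hy
  have hex : e ⟨x, hxW⟩ = y' := Subtype.ext ((he _).trans hx)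
  exact (congrArg Subtype.val (e.symm_apply_apply ⟨x, hxW⟩)).symm.trans
    (congrArg (fun q => (e.symm q).1) hex)

/-- If `f` is an isomorphism over the open `W ⊆ Y`, then `f` maps open subsets of `f ⁻¹ W` onto
open subsets of `Y`. [folklore] -/
theorem isOpen_image_of_isIso_morphismRestrict (hW : IsIso (f ∣_ W)) {O : Set X} (hO : IsOpen O)
    (hOW : O ⊆ (f ⁻¹ᵁ W : Set X)) : IsOpen (f '' O) := by
  let e := Scheme.homeoOfIso (asIso (f ∣_ W))
  have he : ∀ z : ↥(f ⁻¹ᵁ W), (e z).1 = f z.1 := fun z =>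
    morphismRestrict_base_coe f W z
  have : f '' O = W.ι '' (e '' ((f ⁻¹ᵁ W).ι ⁻¹' O)) := by
    ext y
    constructor
    · rintro ⟨x, hx, rfl⟩
      exact ⟨e ⟨x, hOW hx⟩, ⟨⟨x, hOW hx⟩, hx, rfl⟩, he _⟩
    · rintro ⟨_, ⟨z, hz, rfl⟩, rfl⟩
      exact ⟨z.1, hz, (he z).symm⟩
  rw [this]
  exact W.ι.isOpenEmbedding.isOpenMap _
    (e.isOpenMap _ (hO.preimage (f ⁻¹ᵁ W).ι.continuous))

/-- If `f` is an isomorphism over the open `W ⊆ Y` and `B ⊆ Y`, every point of `f ⁻¹ W` lying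
over the closure of `B` lies in the closure of `f ⁻¹ B`. [folklore] -/
theorem preimage_closure_inter_subset_of_isIso_morphismRestrict (hW : IsIso (f ∣_ W))
    (B : Set Y) : f ⁻¹' closure B ∩ (f ⁻¹ᵁ W : Set X) ⊆ closure (f ⁻¹' B) := by
  rintro x ⟨hxB, hxW⟩
  rw [mem_closure_iff]
  intro O hO hxO
  have hO' : IsOpen (f '' (O ∩ (f ⁻¹ᵁ W : Set X))) :=
    isOpen_image_of_isIso_morphismRestrict f hW (hO.inter (f ⁻¹ᵁ W).isOpen)
      Set.inter_subset_right
  obtain ⟨_, ⟨o, ⟨hoO, -⟩, rfl⟩, hoB⟩ := mem_closure_iff.mp hxB _ hO' ⟨x, ⟨hxO, hxW⟩, rfl⟩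
  exact ⟨o, hoO, hoB⟩

end IsoOver

/-! ## Sequences of blow-ups with regular centres and iterated strict transforms -/

/-- **Embedded transform along a sequence of blow-ups** (the data of BGMW 2011, Thm. 2.0.2
(weak-strong Hironaka embedded desingularization), conclusions (1)–(2), without the normal
crossings conditions): `IsEmbeddedTransform Y T σ Y'` says that `σ : X' ⟶ X` is a composite of
finitely many blow-ups `X' = X_r → X_{r-1} → ⋯ → X_0 = X`, each along an ideal sheaf `C_i` on
`X_i` whose closed subscheme `V(C_i)` (the centre) is a *regular* scheme and lies over the subset
`T ⊆ X` (BGMW: smooth centres `C_i` "disjoint from the set `Reg(Y) ⊂ Y_i` of points where `Y`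
(not `Y_i`) is smooth", i.e. `T = X ∖ Reg(Y)`), and that `Y' ⊆ X'` is the iterated **strict
transform** of the subset `Y ⊆ X`: at each step the closure of the preimage of `Y_i ∖ V(C_i)`
(Görtz–Wedhorn I, (13.19), after Prop. 13.96: the strict transform "can also be described as
the schematic closure of `π⁻¹(Y ∖ Z)`"; here only its underlying closed set is recorded, the
reduced induced structure being imposed by the user). Generated by: the identity (no blow-up),
and post-composition with one more blow-up.
[cite: BierstoneGrigorievMilmanWlodarczyk2011, Thm. 2.0.2 (1)–(2)] -/
inductive IsEmbeddedTransform {X : Scheme.{u}} (Y T : Set X) :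
    ∀ ⦃X' : Scheme.{u}⦄, (X' ⟶ X) → Set X' → Prop
  /-- no blow-up yet: `Y` is its own transform along `𝟙 X` -/
  | refl : IsEmbeddedTransform Y T (𝟙 X) Y
  /-- one more blow-up `τ : X'' ⟶ X'` along `C`, with regular centre `V(C)` lying over `T`; the
  new strict transform is the closure of `τ⁻¹(Y' ∖ V(C))` -/
  | blowup ⦃X' X'' : Scheme.{u}⦄ {σ : X' ⟶ X} {Y' : Set X'}
      (h : IsEmbeddedTransform Y T σ Y') (C : X'.IdealSheafData) (τ : X'' ⟶ X')
      (hτ : IsBlowup τ C) (hC : Scheme.IsRegular C.subscheme)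
      (hT : σ '' (C.support : Set X') ⊆ T) :
      IsEmbeddedTransform Y T (τ ≫ σ) (closure (τ ⁻¹' (Y' \ (C.support : Set X'))))

namespace IsEmbeddedTransform

variable {X : Scheme.{u}} {Y T : Set X}

/-- A single blow-up `τ : X' ⟶ X` along `C` with regular centre over `T` is an embedded
transform, with strict transform the closure of `τ⁻¹(Y ∖ V(C))`. [folklore] -/
theorem single (C : X.IdealSheafData) {X' : Scheme.{u}} (τ : X' ⟶ X) (hτ : IsBlowup τ C)
    (hC : Scheme.IsRegular C.subscheme) (hT : (C.support : Set X) ⊆ T) :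
    IsEmbeddedTransform Y T τ (closure (τ ⁻¹' (Y \ (C.support : Set X)))) := by
  have := IsEmbeddedTransform.blowup (IsEmbeddedTransform.refl (Y := Y) (T := T)) C τ hτ hC
    (by simpa using hT)
  simpa using this

/-- **Structure of an embedded transform of an irreducible closed set** `Y = closure {ξ}` whose
generic point `ξ` does not lie in `T` (over a locally Noetherian base, granted that blow-ups
along ideals of finite type are proper, `Stacks02NS`): the composite `σ` of the blow-ups is
proper; it is an isomorphism over an open `V ⊇ X ∖ T` (each blow-up is an isomorphism off its
centre, GW Prop. 13.91 (3), and the centres lie over `T`); and the strict transform is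
irreducible, the closure of the unique point `ξ'` over `ξ`. [folklore] -/
theorem isProper_and_exists (hB : Stacks02NS.{u}) [IsLocallyNoetherian X] {ξ : X}
    (hξ : ξ ∉ T) {X' : Scheme.{u}} {σ : X' ⟶ X} {Y' : Set X'}
    (h : IsEmbeddedTransform (closure {ξ}) T σ Y') :
    IsProper σ ∧ ∃ V : X.Opens, Tᶜ ⊆ (V : Set X) ∧ IsIso (σ ∣_ V) ∧
      ∃ ξ' : X', σ ξ' = ξ ∧ Y' = closure {ξ'} := by
  induction h with
  | refl =>
    refine ⟨inferInstance, ⊤, by simp, ?_, ξ, rfl, rfl⟩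
    infer_instance
  | @blowup X' X'' σ Y' h C τ hτ hC hT ih =>
    obtain ⟨hσ, V, hTV, hiso, ξ', hξ', hY'⟩ := ih
    haveI : IsLocallyNoetherian X' := LocallyOfFiniteType.isLocallyNoetherian σ
    haveI : IsProper τ := hB.of_isLocallyNoetherian τ C hτ
    -- the open complement of the image of the centre
    have hclosed : IsClosed (σ '' (C.support : Set X')) := σ.isClosedMap _ C.support.isClosed
    let V' : X.Opens := V ⊓ ⟨(σ '' (C.support : Set X'))ᶜ, hclosed.isOpen_compl⟩
    have hV'V : V' ≤ V := inf_le_left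
    have hTV' : Tᶜ ⊆ (V' : Set X) := fun x hx => ⟨hTV hx, fun hx' => hx (hT hx')⟩
    -- `τ` is an isomorphism off the centre, in particular over `σ ⁻¹ V'`
    let Wc : X'.Opens := ⟨(C.support : Set X')ᶜ, C.support.isClosed.isOpen_compl⟩
    have hWc : IsIso (τ ∣_ Wc) := hτ.isIso_morphismRestrict disjoint_compl_left
    have hle : σ ⁻¹ᵁ V' ≤ Wc := fun x hx hxC => hx.2 ⟨x, hxC, rfl⟩
    have hiso' : IsIso ((τ ≫ σ) ∣_ V') := by
      rw [morphismRestrict_comp]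
      have h1 := isIso_morphismRestrict_of_le σ hiso hV'V
      have h2 := isIso_morphismRestrict_of_le τ hWc hle
      exact @IsIso.comp_isIso _ _ _ _ _ _ _ h2 h1
    -- the point over `ξ`
    have hξ'C : ξ' ∉ (C.support : Set X') := fun h' => hξ (hT ⟨ξ', h', hξ'⟩)
    obtain ⟨ξ₂, hξ₂, huniq⟩ :=
      existsUnique_preimage_of_isIso_morphismRestrict τ hWc (y := ξ') hξ'C
    have hfib : τ ⁻¹' {ξ'} = {ξ₂} := by
      ext z
      simp only [Set.mem_preimage, Set.mem_singleton_iff]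
      exact ⟨fun hz => huniq z hz, fun hz => hz ▸ hξ₂⟩
    refine ⟨inferInstance, V', hTV', hiso', ξ₂, by rw [Scheme.Hom.comp_apply, hξ₂, hξ'], ?_⟩
    apply le_antisymm
    · refine closure_minimal ?_ isClosed_closure
      rintro x ⟨hxY, hxC⟩
      rw [hY'] at hxY
      have hx := preimage_closure_inter_subset_of_isIso_morphismRestrict τ hWc {ξ'} ⟨hxY, hxC⟩
      rwa [hfib] at hx
    · refine closure_mono (Set.singleton_subset_iff.mpr ?_)
      refine ⟨?_, ?_⟩
      · rw [hY']
        show τ ξ₂ ∈ closure {ξ'}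
        rw [hξ₂]
        exact subset_closure rfl
      · show τ ξ₂ ∉ (C.support : Set X')
        rw [hξ₂]
        exact hξ'C

end IsEmbeddedTransform

/-! ## From an embedded transform with regular strict transform to a resolution -/

open Scheme.IdealSheafData in
/-- **Embedded desingularization ⇒ resolution** (BGMW 2011 §3.3, "(3) ⇒ (4)": "the existence of
canonical embedded desingularization … defines a canonical desingularization"; Thm. 2.0.2 ⇒
Thm. 2.0.3). Let `ι : Y ↪ X` be a closed immersion of an integral scheme into a locally
Noetherian scheme, `σ : X' ⟶ X` a composite of blow-ups with (regular) centres lying over a set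
`T ⊆ X` not containing the generic point of `Y`, and `Y' ⊆ X'` the iterated strict transform of
`ι(Y)`. If the reduced closed subscheme `Ỹ` of `X'` on `Y'` is regular, then `Ỹ → Y` (the
restriction of `σ`) is a resolution of singularities of `Y`: proper (blow-ups of locally
Noetherian schemes are proper, `Stacks02NS`; closed immersions are proper), birational (an
isomorphism over the dense open `ι⁻¹(V)`, `V ⊇ X ∖ T` the open over which `σ` is an
isomorphism) with regular source.
[cite: BierstoneGrigorievMilmanWlodarczyk2011, §3.3 (3)⇒(4) and Thm. 2.0.3] -/
theorem hasResolution_of_isEmbeddedTransform (hB : Stacks02NS.{u}) {X Y X' : Scheme.{u}}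
    [IsLocallyNoetherian X] [IsIntegral Y] (ι : Y ⟶ X) [IsClosedImmersion ι] {T : Set X}
    (hT : ι (genericPoint Y) ∉ T) {σ : X' ⟶ X} {Y' : Set X'}
    (h : IsEmbeddedTransform (Set.range ι) T σ Y')
    (hreg : Scheme.IsRegular
      (vanishingIdeal (⟨closure Y', isClosed_closure⟩ : Closeds X')).subscheme) :
    Scheme.HasResolution Y := by
  classical
  -- `ι(Y)` is the closure of the image `ξ` of the generic point of `Y`
  set ξ : X := ι (genericPoint Y) with hξdef
  have hgen : IsGenericPoint ξ (Set.range ι) := by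
    have := (genericPoint_spec Y).image ι.continuous
    rwa [Set.image_univ, ι.isClosedEmbedding.isClosed_range.closure_eq] at this
  have hYξ : Set.range ι = closure {ξ} := hgen.symm
  rw [hYξ] at h
  obtain ⟨hσ, V, hTV, hiso, ξ', hξ', hY'⟩ := h.isProper_and_exists hB hT
  -- the strict transform `Z = closure {ξ'}` and its reduced structure `Ỹ`
  set Z : Closeds X' := ⟨closure Y', isClosed_closure⟩ with hZdef
  have hZ : (Z : Set X') = closure {ξ'} := by
    change closure Y' = closure {ξ'}
    rw [hY', closure_closure]
  let j := (vanishingIdeal Z).subschemeι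
  haveI : IsIntegral (vanishingIdeal Z).subscheme :=
    isIntegral_subscheme_vanishingIdeal Z
      (hZ ▸ isIrreducible_singleton.closure)
  have hrange : Set.range j = closure {ξ'} := by
    rw [range_subschemeι, coe_support_vanishingIdeal, hZ]
  -- `σ ∘ j` factors through `ι`
  have hker : ι.ker ≤ (j ≫ σ).ker := by
    have e1 : (j ≫ σ).ker = vanishingIdeal (.closure (σ '' (Z : Set X'))) := by
      rw [← map_vanishingIdeal]
      rfl
    rw [e1, ← le_support_iff_le_vanishingIdeal]
    have e2 : (ι.ker.support : Set X) = Set.range ι := by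
      rw [Scheme.Hom.support_ker, ι.isClosedEmbedding.isClosed_range.closure_eq]
    rw [← SetLike.coe_subset_coe, e2, Closeds.closure]
    change closure (σ '' (Z : Set X')) ⊆ Set.range ι
    rw [hYξ, hZ]
    refine closure_minimal ((image_closure_subset_closure_image σ.continuous).trans ?_)
      isClosed_closure
    rw [Set.image_singleton, hξ']
  let ρ : (vanishingIdeal Z).subscheme ⟶ Y := IsClosedImmersion.lift ι (j ≫ σ) hker
  have hρ : ρ ≫ ι = j ≫ σ := IsClosedImmersion.lift_fac ι (j ≫ σ) hker
  have hρapp : ∀ y, ι (ρ y) = σ (j y) := fun y => by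
    rw [← Scheme.Hom.comp_apply, hρ, Scheme.Hom.comp_apply]
  -- properness
  haveI : IsProper ρ := by
    have : IsProper (ρ ≫ ι) := by rw [hρ]; infer_instance
    exact MorphismProperty.of_postcomp (W := @IsProper) (W' := @IsSeparated) ρ ι inferInstance
      this
  -- the dense open `U = ι⁻¹ V` of `Y` and the point `y₀` of `Ỹ` over `ξ'`
  let U : Y.Opens := ι ⁻¹ᵁ V
  have hξV : ξ ∈ V := hTV hT
  have hηU : genericPoint Y ∈ U := hξV
  obtain ⟨y₀, hy₀⟩ : ξ' ∈ Set.range j := by rw [hrange]; exact subset_closure rfl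
  have hfibξ : σ ⁻¹' {ξ} = {ξ'} := by
    obtain ⟨x, -, huniq⟩ := existsUnique_preimage_of_isIso_morphismRestrict σ hiso hξV
    ext z
    simp only [Set.mem_preimage, Set.mem_singleton_iff]
    exact ⟨fun hz => (huniq z hz).trans (huniq ξ' hξ').symm, fun hz => hz ▸ hξ'⟩
  -- points of `X'` over `ι(Y) ∩ V` lie in the strict transform
  have hover : ∀ x : X', σ x ∈ Set.range ι → σ x ∈ V → x ∈ closure {ξ'} := by
    intro x hx hxV
    rw [hYξ] at hx
    have := preimage_closure_inter_subset_of_isIso_morphismRestrict σ hiso {ξ} ⟨hx, hxV⟩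
    rwa [hfibξ] at this
  have hbir : IsBirational ρ := by
    refine ⟨U, ?_, ?_, ?_⟩
    · -- `U` contains the generic point of `Y`
      have hd : Dense ({genericPoint Y} : Set Y) := by
        rw [dense_iff_closure_eq]; exact genericPoint_spec Y
      exact hd.mono (Set.singleton_subset_iff.mpr hηU)
    · -- `ρ⁻¹ U` contains the generic point `y₀` of `Ỹ`
      have hgen' : closure ({y₀} : Set (vanishingIdeal Z).subscheme) = Set.univ := by
        rw [j.isClosedEmbedding.isInducing.closure_eq_preimage_closure_image, Set.image_singleton,
          hy₀, ← hrange, Set.preimage_range]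
      have hd : Dense ({y₀} : Set (vanishingIdeal Z).subscheme) := by
        rw [dense_iff_closure_eq]; exact hgen'
      refine hd.mono (Set.singleton_subset_iff.mpr ?_)
      change ι (ρ y₀) ∈ V
      rw [hρapp, hy₀, hξ']
      exact hξV
    · -- over `U`, `ρ` is a surjective closed immersion onto a reduced scheme
      haveI : IsClosedImmersion (ρ ∣_ U) := by
        have h1 : IsClosedImmersion ((j ≫ σ) ∣_ V) := by
          rw [morphismRestrict_comp]
          haveI := hiso
          exact (MorphismProperty.cancel_right_of_respectsIso @IsClosedImmersion _ _).mpr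
            (IsZariskiLocalAtTarget.restrict (inferInstanceAs (IsClosedImmersion j)) _)
        rw [← hρ, morphismRestrict_comp] at h1
        exact MorphismProperty.of_postcomp (W := @IsClosedImmersion) (W' := @IsSeparated)
          (ρ ∣_ U) (ι ∣_ V) inferInstance h1
      haveI : Surjective (ρ ∣_ U) := by
        refine ⟨fun u => ?_⟩
        have hu : ι u.1 ∈ V := u.2
        obtain ⟨x, hx, -⟩ := existsUnique_preimage_of_isIso_morphismRestrict σ hiso hu
        have hxZ : x ∈ Set.range j := by
          rw [hrange]
          exact hover x (hx ▸ Set.mem_range_self _) (hx ▸ hu)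
        obtain ⟨y₁, rfl⟩ := hxZ
        have hρy₁ : ρ y₁ = u.1 := ι.isClosedEmbedding.injective (by rw [hρapp, hx])
        refine ⟨⟨y₁, show ρ y₁ ∈ U by rw [hρy₁]; exact u.2⟩, Subtype.ext ?_⟩
        rw [morphismRestrict_base_coe]
        exact hρy₁
      exact isIso_of_isClosedImmersion_of_surjective _
  exact ⟨_, ρ, ⟨inferInstance, hbir, hreg⟩⟩

/-! ## BGMW 2011, Cor. 8.0.6 in embedded form (named fact) and the reduction -/

/-- The closed immersion `Y = Spec (k[x₁,…,xₙ] ⧸ (S)) ↪ 𝔸ⁿ_k = Spec k[x₁,…,xₙ]` of the affine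
zero locus of `S`. [folklore] -/
def affineZeroLocusι (k : Type) [Field k] (n : ℕ) (S : Finset (MvPolynomial (Fin n) k)) :
    affineZeroLocus k n S ⟶ Spec (CommRingCat.of (MvPolynomial (Fin n) k)) :=
  Spec.map (CommRingCat.ofHom
    (Ideal.Quotient.mk (Ideal.span (S : Set (MvPolynomial (Fin n) k)))))

/-- `Y = V(S) ↪ 𝔸ⁿ_k` is a closed immersion. [folklore] -/
instance isClosedImmersion_affineZeroLocusι (k : Type) [Field k] (n : ℕ)
    (S : Finset (MvPolynomial (Fin n) k)) : IsClosedImmersion (affineZeroLocusι k n S) := by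
  delta affineZeroLocusι affineZeroLocus
  exact IsClosedImmersion.spec_of_surjective _ Ideal.Quotient.mk_surjective

/-- NAMED FACT — **Bierstone–Grigoriev–Milman–Włodarczyk 2011, Cor. 8.0.6 (arXiv numbering;
Cor. 7.0.6 of the journal version), EMBEDDED form** ("Assume the base field is perfect of
characteristic `p`. There exists a function `M(d, n, l) := M(n, d, n, l, 1) ∈ 𝓔^{n+3}`
(independent of characteristic) such that for all `Y ⊂ 𝔸ⁿ` described by `l` polynomials of
degree less than `n` [sc. at most `d`], for which `M(d, n, l) < p`, there is a canonical
(embedded) resolution of singularities"), where "embedded resolution of singularities" is the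
conclusion of their Thm. 2.0.2 (weak-strong Hironaka embedded desingularization: a sequence of
blow-ups `σᵢ : X_{i-1} ← Xᵢ` of `X₀ = 𝔸ⁿ` with smooth centres `C_{i-1} ⊂ X_{i-1}` such that (1) the
exceptional divisors are snc and the centres snc with them, (2) "all centers `Cᵢ` are disjoint
from the set `Reg(Y) ⊂ Yᵢ` of points where `Y` (not `Yᵢ`) is smooth", (3) the strict transform
`Y_r` of `Y` is smooth and snc with the exceptional divisor, (4) functoriality), obtained in
characteristic `p > M(d,n,l)` from Thm. 8.0.5 (the characteristic-zero algorithm for marked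
ideals runs unchanged while all multiplicities stay `< p`), Lemma 8.0.3 (1) (they are bounded by
`M(d, n, l)`) and the Galois-descent remark (p. 23) passing from `k̄` to a perfect `k`.

Vendored — WEAKER than printed, hence safe as a hypothesis — for INTEGRAL `Y = Spec (k[x]⧸(S))`
(`|S| ≤ l`, degrees `≤ d`), keeping of (1)–(4) only: the `σᵢ` are blow-ups (`IsBlowup`,
universal property, GW Def. 13.90) along ideal sheaves whose centres `V(Cᵢ)` are regular
schemes [printed: smooth] lying over the complement `T` of the image of
`Reg(Y) = {y | 𝒪_{Y,y} regular}` [printed (2), read through the identification of `Reg(Y)` with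
its isomorphic preimage in `Yᵢ`; smooth = regular points over the perfect field `k`], and the
iterated strict transform `Y' ⊆ X_r` of `Y` (closure of the preimage of `Yᵢ ∖ V(Cᵢ)` at each
step, GW (13.19)), with its reduced induced structure, is a regular scheme [printed (3): smooth;
for integral `Y` not meeting the centres generically the iterated strict transform is integral,
so its scheme structure is the reduced one on this closed set]. The threshold is existentially
quantified (`∃ M : ℕ → ℕ → ℕ → ℕ`; membership in `𝓔^{n+3}` not transcribed). Users take
`(h : BierstoneGrigorievMilmanWlodarczyk2011_embedded)`; together with `Stacks02NS` (blow-ups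
are proper) it yields the non-embedded form `BierstoneGrigorievMilmanWlodarczyk2011`
(`bierstoneGrigorievMilmanWlodarczyk2011_of_embedded`).
[cite: BierstoneGrigorievMilmanWlodarczyk2011, Cor. 8.0.6 with Thm. 2.0.2 (1)–(3), Thm. 8.0.5] -/
def BierstoneGrigorievMilmanWlodarczyk2011_embedded : Prop :=
  ∃ M : ℕ → ℕ → ℕ → ℕ,
    ∀ (p : ℕ), p.Prime →
      ∀ (k : Type) [Field k] [CharP k p] [PerfectField k] (n d l : ℕ)
        (S : Finset (MvPolynomial (Fin n) k)),
        S.card ≤ l → (∀ f ∈ S, f.totalDegree ≤ d) → M d n l < p →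
          IsIntegral (affineZeroLocus k n S) →
            ∃ (X' : Scheme.{0}) (σ : X' ⟶ Spec (CommRingCat.of (MvPolynomial (Fin n) k)))
              (Y' : Set X'),
              IsEmbeddedTransform (Set.range (affineZeroLocusι k n S))
                ((affineZeroLocusι k n S) ''
                  {y | IsRegularLocalRing ((affineZeroLocus k n S).presheaf.stalk y)})ᶜ σ Y' ∧
              Scheme.IsRegular (Scheme.IdealSheafData.vanishingIdeal
                (⟨closure Y', isClosed_closure⟩ : Closeds X')).subscheme

/-- **BGMW Cor. 8.0.6, embedded ⇒ non-embedded** (BGMW §3.3, (3) ⇒ (4); Thm. 2.0.2 ⇒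
Thm. 2.0.3): granted that blow-ups along ideals of finite type are proper (`Stacks02NS`:
Stacks 02NS, GW Prop. 13.96 (1)), the embedded form
`BierstoneGrigorievMilmanWlodarczyk2011_embedded` implies the named fact
`BierstoneGrigorievMilmanWlodarczyk2011` — the strict transform with its reduced structure,
mapped to `Y` by the composite of the blow-ups, is a proper birational morphism from a regular
scheme (`hasResolution_of_isEmbeddedTransform`; the generic point of the integral scheme `Y` is a
regular point, its local ring being the function field).
[cite: BierstoneGrigorievMilmanWlodarczyk2011, §3.3 (3)⇒(4), Thm. 2.0.3] -/
theorem bierstoneGrigorievMilmanWlodarczyk2011_of_embedded (hB : Stacks02NS.{0})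
    (hE : BierstoneGrigorievMilmanWlodarczyk2011_embedded) :
    BierstoneGrigorievMilmanWlodarczyk2011 := by
  obtain ⟨M, hM⟩ := hE
  refine ⟨M, fun p hp k _ _ _ n d l S hS hd hMp hint => ?_⟩
  obtain ⟨X', σ, Y', hseq, hreg⟩ := hM p hp k n d l S hS hd hMp hint
  haveI := hint
  refine hasResolution_of_isEmbeddedTransform hB (affineZeroLocusι k n S) ?_ hseq hreg
  simp only [Set.mem_compl_iff, not_not]
  exact ⟨genericPoint _,
    (inferInstance : IsRegularLocalRing (affineZeroLocus k n S).functionField), rfl⟩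

end Literature.AlgebraicGeometry.Resolution
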